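import Literature.NumberTheory.Transcendental.NesterenkoLocalUnmixed
import Literature.NumberTheory.Transcendental.NesterenkoElimination
import Literature.RingTheory.MvPolynomial.HomogeneousDimension
import Literature.RingTheory.GradedAlgebra.HomogeneousAssociatedPrimes
import Mathlib.RingTheory.Ideal.AssociatedPrime.Finiteness
import Mathlib.RingTheory.Regular.RegularSequence
import HarnessLib

/-!
# Hilbert function of a space curve on a complete intersection, I: section numerics (crux `ApproximationProperty`, stub `CycleAPIAt3`)

Crux `stmt-Schanuel-6117` (`Summit.Schanuel.Schanuel.Theses.DiophantineDichotomy.ApproximationProperty`),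
line `orbit-interpolation-determinant`, registered stub `CycleAPIAt3 : CycleAPIAt 3`, whose docstring
(skeleton `Lines/orbit_interpolation_determinant.lean`) names as THE OPEN STEP of the `t = 3` descent a
LOWER BOUND for the Hilbert function of a homogeneous prime `𝔭 ⊂ ℚ[x₀, …, x₃]` of Krull dimension `2`
(a space curve) lying on a complete intersection of two forms of degrees `a`, `b`. This file and its
sequels (`…CurveHilbertTelescope`, `…CurveHilbertGenericSection`, `…CurveHilbertLB`) prove
`H(𝔭; ν) ≥ (ν − a − b) · deg 𝔭` for `ν ≥ a + b`. Everything here is PROVED; no definitions.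

This file: the auxiliary one-dimensional complete intersection `(Q, P, ℓ)` of `S = ℚ[x₀, …, x₃]`
(`Rx 3`), `Q ≠ 0` a form of degree `a ≥ 1` generating a prime ideal, `P ∉ (Q)` a form of degree
`b ≥ 1`, `ℓ` a linear form outside the associated primes of `(Q, P)`:
`ringKrullDim_quotient_QP` / `ringKrullDim_quotient_QPl` (Macaulay's unmixedness at the irrelevant
prime for the avoiding sequences `[Q, P]`, `[Q, P, ℓ]`, tree
`Nesterenko.ringKrullDim_quotient_eq_of_mem_associatedPrimes_of_avoids`, `m = 3`),
`nzd_of_forall_notMem` (outside the associated primes ⇒ non-zero-divisor),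
`idealDegree_QPlL_eq` (`(Q, P, ℓ, L)_{s+1} = S_{s+1}` for `s ≥ a + b + 1`, four hypersurface-section
formulas `finrank_idealDegree_sup_span_add_eq`), and the consequence `curveHilbert_sectionConstancy`: for every
homogeneous `J ⊇ (Q, P, ℓ)` modulo which the linear form `L` is a non-zero-divisor, `H(J; j)` is
CONSTANT for `j ≥ a + b + 1` (`·L` is injective on `S/J` and onto above `a + b + 1`).

Sources: Nesterenko–Philippon (eds.), LNM 1752, Ch. 10 §3, Ch. 11 §2.2; Philippon, Bull. SMF 114
(1986), Lemme 3.1; M. Chardin, Bull. SMF 117 (1989).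
-/

set_option linter.dupNamespace false

noncomputable section

namespace Summit.Schanuel.Schanuel.Cruxes.ApproximationProperty.OrbitInterpolationDeterminant

open Literature.NumberTheory.Transcendental.Nesterenko MvPolynomial Module
open Literature.RingTheory.MvPolynomial

namespace CurveHilbert

/-! ## Generalities -/

/-- A form of positive degree lies in the irrelevant ideal `ker constantCoeff`. [folklore] -/
theorem mem_ker_constantCoeff_of_isHomogeneous {P : Rx 3} {n : ℕ} (hP : P.IsHomogeneous n)
    (hn : 1 ≤ n) : P ∈ RingHom.ker (constantCoeff : Rx 3 →+* ℚ) := by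
  rw [RingHom.mem_ker, constantCoeff_eq]
  exact hP.coeff_eq_zero (by rw [map_zero]; omega)

/-- `span {P}` is a homogeneous ideal for a form `P`. [folklore] -/
theorem isHomogeneous_span [GradedAlgebra (homogeneousSubmodule (Fin (3 + 1)) ℚ)] {P : Rx 3} {n : ℕ}
    (hP : P.IsHomogeneous n) :
    (Ideal.span {P}).IsHomogeneous (homogeneousSubmodule (Fin (3 + 1)) ℚ) :=
  Ideal.homogeneous_span _ _ fun x hx => ⟨n, by rw [Set.mem_singleton_iff.mp hx]; exact hP⟩

/-- A minimal prime of `I` is an associated prime of `R ⧸ I` (Noetherian `R`). [folklore] -/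
theorem mem_associatedPrimes_of_mem_minimalPrimes {R : Type*} [CommRing R] [IsNoetherianRing R]
    {I p : Ideal R} (hp : p ∈ I.minimalPrimes) : p ∈ associatedPrimes R (R ⧸ I) := by
  have h := Module.associatedPrimes.minimalPrimes_annihilator_subset_associatedPrimes
    (R := R) (M := R ⧸ I)
  rw [Ideal.annihilator_quotient] at h
  exact h hp

/-- **An element outside every associated prime of `R ⧸ J` is a non-zero-divisor modulo `J`**
(Noetherian `R`; the zero-divisors of a module are the union of its associated primes).
[folklore] -/
theorem nzd_of_forall_notMem {R : Type*} [CommRing R] [IsNoetherianRing R] (J : Ideal R) (x : R)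
    (hx : ∀ 𝔯 ∈ associatedPrimes R (R ⧸ J), x ∉ 𝔯) : ∀ f, x * f ∈ J → f ∈ J := by
  intro f hf
  by_contra hfJ
  have hmk : Ideal.Quotient.mk J f ≠ 0 := mt Ideal.Quotient.eq_zero_iff_mem.mp hfJ
  have hzero : x • Ideal.Quotient.mk J f = 0 := by
    rw [Algebra.smul_def, Ideal.Quotient.algebraMap_eq, ← map_mul, Ideal.Quotient.eq_zero_iff_mem]
    exact hf
  have hmem : x ∈ {r : R | ∃ y : R ⧸ J, y ≠ 0 ∧ r • y = 0} := ⟨_, hmk, hzero⟩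
  rw [← biUnion_associatedPrimes_eq_zero_divisors] at hmem
  obtain ⟨𝔯, h𝔯, hx𝔯⟩ := Set.mem_iUnion₂.mp hmem
  exact hx 𝔯 h𝔯 hx𝔯

/-! ## Macaulay: the associated primes of `(Q, P)` and of `(Q, P, ℓ)` -/

/-- **Macaulay's unmixedness for `(Q, P)` in `ℚ[x₀, …, x₃]`.** For `Q ≠ 0` a form of degree `a ≥ 1`
with `(Q)` prime and `P ∉ (Q)` a form of degree `b ≥ 1`, every associated prime `𝔯` of `S/(Q, P)`
has `dim S/𝔯 = 2` (no embedded component). [cite: NesterenkoPhilippon2001, Ch. 10 §3, proof of Prop. 3.6] -/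
theorem ringKrullDim_quotient_QP {Q P : Rx 3} {a b : ℕ} (hQ0 : Q ≠ 0)
    (hQ : Q.IsHomogeneous a) (hP : P.IsHomogeneous b) (ha : 1 ≤ a) (hb : 1 ≤ b)
    (hprime : (Ideal.span {Q}).IsPrime) (hPQ : P ∉ Ideal.span {Q}) {𝔯 : Ideal (Rx 3)}
    (h𝔯 : 𝔯 ∈ associatedPrimes (Rx 3) (Rx 3 ⧸ (Ideal.span {Q} ⊔ Ideal.span {P}))) :
    ringKrullDim (Rx 3 ⧸ 𝔯) = (2 : ℕ) := by
  have hE : Ideal.ofList [Q, P] = Ideal.span {Q} ⊔ Ideal.span {P} := by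
    rw [Ideal.ofList_cons, Ideal.ofList_singleton]
  rw [← hE] at h𝔯
  have h𝔯' := (mem_associatedPrimes_quotient_iff _ _).mp h𝔯
  set 𝔪 : Ideal (Rx 3) := RingHom.ker (constantCoeff : Rx 3 →+* ℚ)
  haveI : 𝔪.IsPrime := isMaximal_ker_constantCoeff.isPrime
  have hE𝔪 : ∀ e ∈ [Q, P], e ∈ 𝔪 := by
    intro e he
    simp only [List.mem_cons, List.not_mem_nil, or_false] at he
    rcases he with rfl | rfl
    · exact mem_ker_constantCoeff_of_isHomogeneous hQ ha
    · exact mem_ker_constantCoeff_of_isHomogeneous hP hb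
  have havoid : ∀ (L₁ : List (Rx 3)) (e : Rx 3) (L₂ : List (Rx 3)), [Q, P] = L₁ ++ e :: L₂ →
      ∀ 𝔮 ∈ (Ideal.ofList L₁).minimalPrimes, 𝔮 ≤ 𝔪 → e ∉ 𝔮 := by
    intro L₁ e L₂ hsplit 𝔮 h𝔮 _
    rcases L₁ with _ | ⟨x, _ | ⟨y, L₁'⟩⟩
    · rw [List.nil_append] at hsplit
      obtain ⟨hQe, -⟩ := List.cons_eq_cons.mp hsplit
      rw [Ideal.ofList_nil, Ideal.minimalPrimes_eq_subsingleton_self, Set.mem_singleton_iff] at h𝔮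
      rw [← hQe, h𝔮, Ideal.mem_bot]
      exact hQ0
    · rw [List.singleton_append] at hsplit
      obtain ⟨hQx, hrest⟩ := List.cons_eq_cons.mp hsplit
      obtain ⟨hPe, -⟩ := List.cons_eq_cons.mp hrest
      rw [← hQx, Ideal.ofList_singleton] at h𝔮
      haveI := hprime
      rw [Ideal.minimalPrimes_eq_subsingleton_self, Set.mem_singleton_iff] at h𝔮
      rw [← hPe, h𝔮]
      exact hPQ
    · have := congrArg List.length hsplit
      simp only [List.length_cons, List.length_append, List.length_nil] at this
      omega
  letI : GradedAlgebra (homogeneousSubmodule (Fin (3 + 1)) ℚ) := MvPolynomial.gradedAlgebra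
  have hJhom : (Ideal.ofList [Q, P]).IsHomogeneous (homogeneousSubmodule (Fin (3 + 1)) ℚ) := by
    rw [hE]; exact (isHomogeneous_span hQ).sup (isHomogeneous_span hP)
  have h𝔯hom := Literature.RingTheory.GradedAlgebra.isHomogeneous_of_mem_associatedPrimes
    (homogeneousSubmodule (Fin (3 + 1)) ℚ) hJhom h𝔯'
  have h𝔯𝔪 : 𝔯 ≤ 𝔪 :=
    le_ker_constantCoeff_of_isHomogeneous h𝔯hom (IsAssociatedPrime.isPrime h𝔯).ne_top
  have h := (ringKrullDim_quotient_eq_of_mem_associatedPrimes_of_avoids (m := 3) 𝔪 hE𝔪 havoid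
    h𝔯' h𝔯𝔪).2.2
  rw [h]
  rfl

/-- **Macaulay's unmixedness for `(Q, P, ℓ)`**: with `Q`, `P` as above and `ℓ` a linear form lying
in no associated prime of `S/(Q, P)`, every associated prime `𝔯` of `S/(Q, P, ℓ)` has
`dim S/𝔯 = 1`. [cite: NesterenkoPhilippon2001, Ch. 10 §3, proof of Prop. 3.6] -/
theorem ringKrullDim_quotient_QPl {Q P ℓ : Rx 3} {a b : ℕ} (hQ0 : Q ≠ 0)
    (hQ : Q.IsHomogeneous a) (hP : P.IsHomogeneous b) (ha : 1 ≤ a) (hb : 1 ≤ b)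
    (hprime : (Ideal.span {Q}).IsPrime) (hPQ : P ∉ Ideal.span {Q}) (hℓ1 : ℓ.IsHomogeneous 1)
    (hℓ : ∀ 𝔯 ∈ associatedPrimes (Rx 3) (Rx 3 ⧸ (Ideal.span {Q} ⊔ Ideal.span {P})), ℓ ∉ 𝔯)
    {𝔯 : Ideal (Rx 3)}
    (h𝔯 : 𝔯 ∈ associatedPrimes (Rx 3)
      (Rx 3 ⧸ (Ideal.span {Q} ⊔ Ideal.span {P} ⊔ Ideal.span {ℓ}))) :
    ringKrullDim (Rx 3 ⧸ 𝔯) = (1 : ℕ) := by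
  have hE2 : Ideal.ofList [Q, P] = Ideal.span {Q} ⊔ Ideal.span {P} := by
    rw [Ideal.ofList_cons, Ideal.ofList_singleton]
  have hE : Ideal.ofList [Q, P, ℓ] = Ideal.span {Q} ⊔ Ideal.span {P} ⊔ Ideal.span {ℓ} := by
    rw [Ideal.ofList_cons, Ideal.ofList_cons, Ideal.ofList_singleton, sup_assoc]
  rw [← hE] at h𝔯
  have h𝔯' := (mem_associatedPrimes_quotient_iff _ _).mp h𝔯
  set 𝔪 : Ideal (Rx 3) := RingHom.ker (constantCoeff : Rx 3 →+* ℚ)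
  haveI : 𝔪.IsPrime := isMaximal_ker_constantCoeff.isPrime
  have hE𝔪 : ∀ e ∈ [Q, P, ℓ], e ∈ 𝔪 := by
    intro e he
    simp only [List.mem_cons, List.not_mem_nil, or_false] at he
    rcases he with rfl | rfl | rfl
    · exact mem_ker_constantCoeff_of_isHomogeneous hQ ha
    · exact mem_ker_constantCoeff_of_isHomogeneous hP hb
    · exact mem_ker_constantCoeff_of_isHomogeneous hℓ1 le_rfl
  have havoid : ∀ (L₁ : List (Rx 3)) (e : Rx 3) (L₂ : List (Rx 3)), [Q, P, ℓ] = L₁ ++ e :: L₂ →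
      ∀ 𝔮 ∈ (Ideal.ofList L₁).minimalPrimes, 𝔮 ≤ 𝔪 → e ∉ 𝔮 := by
    intro L₁ e L₂ hsplit 𝔮 h𝔮 _
    rcases L₁ with _ | ⟨x, _ | ⟨y, _ | ⟨z, L₁'⟩⟩⟩
    · rw [List.nil_append] at hsplit
      obtain ⟨hQe, -⟩ := List.cons_eq_cons.mp hsplit
      rw [Ideal.ofList_nil, Ideal.minimalPrimes_eq_subsingleton_self, Set.mem_singleton_iff] at h𝔮
      rw [← hQe, h𝔮, Ideal.mem_bot]
      exact hQ0
    · rw [List.singleton_append] at hsplit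
      obtain ⟨hQx, hrest⟩ := List.cons_eq_cons.mp hsplit
      obtain ⟨hPe, -⟩ := List.cons_eq_cons.mp hrest
      rw [← hQx, Ideal.ofList_singleton] at h𝔮
      haveI := hprime
      rw [Ideal.minimalPrimes_eq_subsingleton_self, Set.mem_singleton_iff] at h𝔮
      rw [← hPe, h𝔮]
      exact hPQ
    · have hsplit' : [Q, P, ℓ] = x :: y :: (e :: L₂) := by simpa using hsplit
      obtain ⟨hQx, hrest⟩ := List.cons_eq_cons.mp hsplit'
      obtain ⟨hPy, hrest'⟩ := List.cons_eq_cons.mp hrest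
      obtain ⟨hℓe, -⟩ := List.cons_eq_cons.mp hrest'
      rw [← hQx, ← hPy, hE2] at h𝔮
      rw [← hℓe]
      exact hℓ 𝔮 (mem_associatedPrimes_of_mem_minimalPrimes h𝔮)
    · have := congrArg List.length hsplit
      simp only [List.length_cons, List.length_append, List.length_nil] at this
      omega
  letI : GradedAlgebra (homogeneousSubmodule (Fin (3 + 1)) ℚ) := MvPolynomial.gradedAlgebra
  have hJhom : (Ideal.ofList [Q, P, ℓ]).IsHomogeneous (homogeneousSubmodule (Fin (3 + 1)) ℚ) := by
    rw [hE]; exact ((isHomogeneous_span hQ).sup (isHomogeneous_span hP)).sup (isHomogeneous_span hℓ1)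
  have h𝔯hom := Literature.RingTheory.GradedAlgebra.isHomogeneous_of_mem_associatedPrimes
    (homogeneousSubmodule (Fin (3 + 1)) ℚ) hJhom h𝔯'
  have h𝔯𝔪 : 𝔯 ≤ 𝔪 :=
    le_ker_constantCoeff_of_isHomogeneous h𝔯hom (IsAssociatedPrime.isPrime h𝔯).ne_top
  have h := (ringKrullDim_quotient_eq_of_mem_associatedPrimes_of_avoids (m := 3) 𝔪 hE𝔪 havoid
    h𝔯' h𝔯𝔪).2.2
  rw [h]
  rfl

/-! ## Hilbert-function bookkeeping for the regular sequence `Q, P, ℓ, L` -/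

/-- The Koszul numerics of four hypersurface sections of degrees `a, b, 1, 1` in four variables:
with `d (n+1) = d n + e (n+1)`, `e (n+1) = e n + (n+2)` (Pascal for `C(n+3,3)` and `C(n+2,2)`),
`q (t+a) = d t` (the section `(0) + (Q)`), `j (t+b) + q t = q (t+b) + d t` (`(Q) + (P)`),
`k (t+1) + j t = j (t+1) + d t` (`(Q,P) + (ℓ)`) and `kl (s+1) + k s = k (s+1) + d s`
(`(Q,P,ℓ) + (L)`), one gets `kl (s+1) = d (s+1)` for `s ≥ a + b + 1`. [folklore] -/
theorem hilbert_arith4 {d e q j k kl : ℕ → ℕ} {a b s : ℕ} (hs : a + b + 1 ≤ s)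
    (hd : ∀ n, d (n + 1) = d n + e (n + 1)) (he : ∀ n, e (n + 1) = e n + (n + 2))
    (hq : ∀ t n, n = t + a → q n = d t)
    (hj : ∀ t n, n = t + b → j n + q t = q n + d t)
    (hk : ∀ t, k (t + 1) + j t = j (t + 1) + d t)
    (hkl : kl (s + 1) + k s = k (s + 1) + d s) :
    kl (s + 1) = d (s + 1) := by
  obtain ⟨v, rfl⟩ : ∃ v, s = v + a + b + 1 := ⟨s - a - b - 1, by omega⟩
  -- `q` on the needed range (arguments spelled exactly as they arise below)
  have q1 := hq (v + b + 1 + 1) (v + a + b + 1 + 1) (by omega)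
  have q2 := hq (v + b + 1) (v + a + b + 1) (by omega)
  have q3 := hq (v + b) (v + a + b) (by omega)
  have q4 := hq (v + 1 + 1) (v + a + 1 + 1) (by omega)
  have q5 := hq (v + 1) (v + a + 1) (by omega)
  have q6 := hq v (v + a) rfl
  -- `j` on the needed range
  have j1 := hj (v + a + 1 + 1) (v + a + b + 1 + 1) (by omega)
  have j2 := hj (v + a + 1) (v + a + b + 1) (by omega)
  have j3 := hj (v + a) (v + a + b) rfl
  -- `k` steps
  have k1 := hk (v + a + b + 1)
  have k2 := hk (v + a + b)
  -- Pascal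
  have d1 := hd (v + a + b + 1)
  have d2 := hd (v + a + b)
  have d3 := hd (v + b + 1)
  have d4 := hd (v + b)
  have d5 := hd (v + a + 1)
  have d6 := hd (v + a)
  have d7 := hd (v + 1)
  have d8 := hd v
  have e1 := he (v + a + b + 1)
  have e2 := he (v + b + 1)
  have e3 := he (v + a + 1)
  have e4 := he (v + 1)
  omega

/-- Pascal's rule for `dim S_n = C(n + 3, 3)` in `S = ℚ[x₀, …, x₃]`:
`dim S_{n+1} = dim S_n + C(n + 3, 2)`. [folklore] -/
theorem finrank_homogeneousSubmodule_succ (n : ℕ) :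
    finrank ℚ (homogeneousSubmodule (Fin (3 + 1)) ℚ (n + 1)) =
      finrank ℚ (homogeneousSubmodule (Fin (3 + 1)) ℚ n) + (n + 1 + 2).choose (n + 1) := by
  rw [Literature.RingTheory.HilbertSamuel.finrank_homogeneousSubmodule_fin,
    Literature.RingTheory.HilbertSamuel.finrank_homogeneousSubmodule_fin,
    show n + 1 + (3 + 1) - 1 = n + 3 + 1 by omega, show n + (3 + 1) - 1 = n + 3 by omega,
    show n + 1 + 2 = n + 3 by omega]
  exact Nat.choose_succ_succ (n + 3) n

/-- Pascal's rule for `C(n + 2, 2)`: `C(n + 3, 2) = C(n + 2, 2) + (n + 2)`. [folklore] -/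
theorem choose_two_succ (n : ℕ) :
    (n + 1 + 2).choose (n + 1) = (n + 2).choose n + (n + 2) := by
  rw [show n + 1 + 2 = n + 2 + 1 by omega, Nat.choose_succ_succ (n + 2) n,
    Nat.choose_succ_self_right]

/-- **`(Q, P, ℓ, L)_{s+1} = S_{s+1}` for `s ≥ a + b + 1`**, when `ℓ` is a linear non-zero-divisor
modulo `(Q, P)` and `L` a linear non-zero-divisor modulo `(Q, P, ℓ)` (four applications of the
hypersurface-section formula). [cite: Philippon1986, Lemme 3.1] -/
theorem idealDegree_QPlL_eq {Q P ℓ L : Rx 3} {a b : ℕ} (hQ0 : Q ≠ 0)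
    (hQ : Q.IsHomogeneous a) (hP : P.IsHomogeneous b)
    (hprime : (Ideal.span {Q}).IsPrime) (hPQ : P ∉ Ideal.span {Q})
    (hℓ1 : ℓ.IsHomogeneous 1) (hℓ0 : ℓ ≠ 0)
    (hnzdℓ : ∀ f, ℓ * f ∈ Ideal.span {Q} ⊔ Ideal.span {P} → f ∈ Ideal.span {Q} ⊔ Ideal.span {P})
    (hL1 : L.IsHomogeneous 1) (hL0 : L ≠ 0)
    (hnzdL : ∀ f, L * f ∈ Ideal.span {Q} ⊔ Ideal.span {P} ⊔ Ideal.span {ℓ} →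
      f ∈ Ideal.span {Q} ⊔ Ideal.span {P} ⊔ Ideal.span {ℓ})
    {s : ℕ} (hs : a + b + 1 ≤ s) :
    idealDegree (Ideal.span {Q} ⊔ Ideal.span {P} ⊔ Ideal.span {ℓ} ⊔ Ideal.span {L}) (s + 1) =
      homogeneousSubmodule (Fin (3 + 1)) ℚ (s + 1) := by
  letI : GradedAlgebra (homogeneousSubmodule (Fin (3 + 1)) ℚ) := MvPolynomial.gradedAlgebra
  have hQhom := isHomogeneous_span hQ
  have hJhom :
      (Ideal.span {Q} ⊔ Ideal.span {P}).IsHomogeneous (homogeneousSubmodule (Fin (3 + 1)) ℚ) :=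
    hQhom.sup (isHomogeneous_span hP)
  have hIhom : (Ideal.span {Q} ⊔ Ideal.span {P} ⊔ Ideal.span {ℓ}).IsHomogeneous
      (homogeneousSubmodule (Fin (3 + 1)) ℚ) := hJhom.sup (isHomogeneous_span hℓ1)
  have hP0 : P ≠ 0 := by
    rintro rfl
    exact hPQ (Ideal.zero_mem _)
  have hnzdQ : ∀ f, Q * f ∈ (⊥ : Ideal (Rx 3)) → f ∈ (⊥ : Ideal (Rx 3)) := fun f hf => by
    rw [Ideal.mem_bot] at hf ⊢
    exact (mul_eq_zero.mp hf).resolve_left hQ0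
  have hnzdP : ∀ f, P * f ∈ Ideal.span {Q} → f ∈ Ideal.span {Q} := fun f hf =>
    (hprime.mem_or_mem hf).resolve_left hPQ
  have hq : ∀ t n, n = t + a → finrank ℚ (idealDegree (Ideal.span {Q}) n) =
      finrank ℚ (homogeneousSubmodule (Fin (3 + 1)) ℚ t) := by
    rintro t n rfl
    have h := finrank_idealDegree_sup_span_add_eq (Ideal.IsHomogeneous.bot _) hQ0 hQ hnzdQ t
    rw [bot_sup_eq, idealDegree_bot, idealDegree_bot, finrank_bot] at h
    simpa using h
  have hj : ∀ t n, n = t + b →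
      finrank ℚ (idealDegree (Ideal.span {Q} ⊔ Ideal.span {P}) n) +
        finrank ℚ (idealDegree (Ideal.span {Q}) t) =
      finrank ℚ (idealDegree (Ideal.span {Q}) n) +
        finrank ℚ (homogeneousSubmodule (Fin (3 + 1)) ℚ t) := by
    rintro t n rfl
    exact finrank_idealDegree_sup_span_add_eq hQhom hP0 hP hnzdP t
  have hk : ∀ t, finrank ℚ (idealDegree (Ideal.span {Q} ⊔ Ideal.span {P} ⊔ Ideal.span {ℓ}) (t + 1)) +
        finrank ℚ (idealDegree (Ideal.span {Q} ⊔ Ideal.span {P}) t) =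
      finrank ℚ (idealDegree (Ideal.span {Q} ⊔ Ideal.span {P}) (t + 1)) +
        finrank ℚ (homogeneousSubmodule (Fin (3 + 1)) ℚ t) := fun t =>
    finrank_idealDegree_sup_span_add_eq hJhom hℓ0 hℓ1 hnzdℓ t
  have hkl := finrank_idealDegree_sup_span_add_eq hIhom hL0 hL1 hnzdL s
  have hfin := hilbert_arith4 (d := fun n => finrank ℚ (homogeneousSubmodule (Fin (3 + 1)) ℚ n))
    (e := fun n => (n + 2).choose n)
    (q := fun n => finrank ℚ (idealDegree (Ideal.span {Q}) n))
    (j := fun n => finrank ℚ (idealDegree (Ideal.span {Q} ⊔ Ideal.span {P}) n))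
    (k := fun n => finrank ℚ (idealDegree (Ideal.span {Q} ⊔ Ideal.span {P} ⊔ Ideal.span {ℓ}) n))
    (kl := fun n => finrank ℚ
      (idealDegree (Ideal.span {Q} ⊔ Ideal.span {P} ⊔ Ideal.span {ℓ} ⊔ Ideal.span {L}) n)) hs
    finrank_homogeneousSubmodule_succ choose_two_succ hq hj hk hkl
  haveI := finite_homogeneousSubmodule (K := ℚ) (σ := Fin (3 + 1)) (s + 1)
  exact Submodule.eq_of_le_of_finrank_eq (idealDegree_le_homogeneousSubmodule _ _) hfin

/-! ## The Hilbert function of an over-ideal is constant above `a + b + 1` -/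

/-- **Section constancy.** Let `(Q, P, ℓ, L)` be as in `idealDegree_QPlL_eq` and `J ⊇ (Q, P, ℓ)` a
homogeneous ideal modulo which `L` is a non-zero-divisor. Then `H(J; j + 1) = H(J; j)` for every
`j ≥ a + b + 1` (`·L : (S/J)_j → (S/J)_{j+1}` is injective, and onto since
`S_{j+1} = (Q, P, ℓ, L)_{j+1} ⊆ L S_j + J_{j+1}`). [cite: Philippon1986, Lemme 3.1] -/
theorem hilbert_succ_eq {Q P ℓ L : Rx 3} {a b : ℕ} (hQ0 : Q ≠ 0)
    (hQ : Q.IsHomogeneous a) (hP : P.IsHomogeneous b)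
    (hprime : (Ideal.span {Q}).IsPrime) (hPQ : P ∉ Ideal.span {Q})
    (hℓ1 : ℓ.IsHomogeneous 1) (hℓ0 : ℓ ≠ 0)
    (hnzdℓ : ∀ f, ℓ * f ∈ Ideal.span {Q} ⊔ Ideal.span {P} → f ∈ Ideal.span {Q} ⊔ Ideal.span {P})
    (hL1 : L.IsHomogeneous 1) (hL0 : L ≠ 0)
    (hnzdL : ∀ f, L * f ∈ Ideal.span {Q} ⊔ Ideal.span {P} ⊔ Ideal.span {ℓ} →
      f ∈ Ideal.span {Q} ⊔ Ideal.span {P} ⊔ Ideal.span {ℓ})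
    {J : Ideal (Rx 3)}
    (hJ : letI := MvPolynomial.gradedAlgebra (σ := Fin (3 + 1)) (R := ℚ)
      J.IsHomogeneous (homogeneousSubmodule (Fin (3 + 1)) ℚ))
    (hIJ : Ideal.span {Q} ⊔ Ideal.span {P} ⊔ Ideal.span {ℓ} ≤ J)
    (hnzdJ : ∀ f, L * f ∈ J → f ∈ J) {j : ℕ} (hj : a + b + 1 ≤ j) :
    finrank ℚ (homogeneousSubmodule (Fin (3 + 1)) ℚ (j + 1)) - finrank ℚ (idealDegree J (j + 1)) =
      finrank ℚ (homogeneousSubmodule (Fin (3 + 1)) ℚ j) - finrank ℚ (idealDegree J j) := by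
  letI : GradedAlgebra (homogeneousSubmodule (Fin (3 + 1)) ℚ) := MvPolynomial.gradedAlgebra
  have hsec := finrank_idealDegree_sup_span_add_eq hJ hL0 hL1 hnzdJ j
  have hfull := idealDegree_QPlL_eq hQ0 hQ hP hprime hPQ hℓ1 hℓ0 hnzdℓ hL1 hL0 hnzdL hj
  have hle : idealDegree (Ideal.span {Q} ⊔ Ideal.span {P} ⊔ Ideal.span {ℓ} ⊔ Ideal.span {L}) (j + 1) ≤
      idealDegree (J ⊔ Ideal.span {L}) (j + 1) := idealDegree_mono (sup_le_sup_right hIJ _) _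
  rw [hfull] at hle
  haveI := finite_homogeneousSubmodule (K := ℚ) (σ := Fin (3 + 1)) (j + 1)
  have heq : idealDegree (J ⊔ Ideal.span {L}) (j + 1) = homogeneousSubmodule (Fin (3 + 1)) ℚ (j + 1) :=
    le_antisymm (idealDegree_le_homogeneousSubmodule _ _) hle
  rw [heq] at hsec
  have h1 := finrank_idealDegree_le J j
  have h2 := finrank_idealDegree_le J (j + 1)
  omega

end CurveHilbert

/-- **Section constancy (registered helper `curveHilbert_sectionConstancy`).** For `Q ≠ 0` a form of
degree `a` of `S = ℚ[x₀, …, x₃]` with `(Q)` prime, `P ∉ (Q)` a form of degree `b`, a linear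
non-zero-divisor `ℓ` modulo `(Q, P)`, a linear non-zero-divisor `L` modulo `(Q, P, ℓ)`, and a
homogeneous ideal `J ⊇ (Q, P, ℓ)` modulo which `L` is a non-zero-divisor:
`H(J; j) = H(J; a + b + 1)` for all `j ≥ a + b + 1`. [cite: Philippon1986, Lemme 3.1] -/
theorem curveHilbert_sectionConstancy :
    ∀ (Q P ℓ L : Rx 3) (a b : ℕ), Q ≠ 0 → Q.IsHomogeneous a → P.IsHomogeneous b →
      (Ideal.span {Q}).IsPrime → P ∉ Ideal.span {Q} → ℓ.IsHomogeneous 1 → ℓ ≠ 0 →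
      (∀ f, ℓ * f ∈ Ideal.span {Q} ⊔ Ideal.span {P} → f ∈ Ideal.span {Q} ⊔ Ideal.span {P}) →
      L.IsHomogeneous 1 → L ≠ 0 →
      (∀ f, L * f ∈ Ideal.span {Q} ⊔ Ideal.span {P} ⊔ Ideal.span {ℓ} →
        f ∈ Ideal.span {Q} ⊔ Ideal.span {P} ⊔ Ideal.span {ℓ}) →
      ∀ J : Ideal (Rx 3),
        (letI := MvPolynomial.gradedAlgebra (σ := Fin (3 + 1)) (R := ℚ);
          J.IsHomogeneous (homogeneousSubmodule (Fin (3 + 1)) ℚ)) →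
        Ideal.span {Q} ⊔ Ideal.span {P} ⊔ Ideal.span {ℓ} ≤ J → (∀ f, L * f ∈ J → f ∈ J) →
        ∀ j, a + b + 1 ≤ j →
          Module.finrank ℚ ↥(homogeneousSubmodule (Fin (3 + 1)) ℚ j) -
              Module.finrank ℚ ↥(Literature.RingTheory.MvPolynomial.idealDegree J j) =
            Module.finrank ℚ ↥(homogeneousSubmodule (Fin (3 + 1)) ℚ (a + b + 1)) -
              Module.finrank ℚ ↥(Literature.RingTheory.MvPolynomial.idealDegree J (a + b + 1)) := by
  intro Q P ℓ L a b hQ0 hQ hP hprime hPQ hℓ1 hℓ0 hnzdℓ hL1 hL0 hnzdL J hJ hIJ hnzdJ j hj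
  obtain ⟨n, rfl⟩ : ∃ n, j = a + b + 1 + n := ⟨j - (a + b + 1), by omega⟩
  induction n with
  | zero => rfl
  | succ n ih =>
    rw [← add_assoc, CurveHilbert.hilbert_succ_eq hQ0 hQ hP hprime hPQ hℓ1 hℓ0 hnzdℓ hL1 hL0 hnzdL
      hJ hIJ hnzdJ (by omega)]
    exact ih (by omega)


end Summit.Schanuel.Schanuel.Cruxes.ApproximationProperty.OrbitInterpolationDeterminant

end
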